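import Literature.AlgebraicGeometry.Frobenioids.Monoids
import Summits.ABC.IUTFork.Joshi.FrobenioidsJoshi

/-!
# Joshi, ATS III (arXiv 2401.13508v4) Prop. 10.4.1.1 (1) in [FrdI]'s MONOID vocabulary: `Φ(K)` is a perfect monoid

Proof-only companion (abc-iut cell, branch E, seat abc-iut-E-t34; typer-side second read of seat E-t32's landed
`Joshi/FrobenioidsJoshi.lean`, p430621; rung LADDER-ABC:A2.E). TAKES NO SIDE on [IUTchIII] Cor. 3.12 or on any
author; typed ≠ proved; nothing here is asserted beyond what the kernel checks. [claim: Joshi2024ATS3, status: disputed]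

WHAT. Joshi, Prop. 10.4.1.1 (1) (p.132 l.36–p.133 l.1): "`Frob(K)` is a perfect Frobenioid in the sense of
[Mochizuki, 2008, Definition 1.1]". E-t32 types its content as `Frob.IsPerfectDiv v` — `n`-th roots exist in the
divisor GROUP `Φ(K)^gp = |K^*|` — and derives it for algebraically closed `K` (`Frob.isPerfectDiv_of_isAlgClosed`).
[FrdI] §0 (p.11) defines "perfect" for the divisor MONOID: "multiplication by every `n ∈ ℕ_{≥1}` is bijective" — our
side's `Literature.AlgebraicGeometry.Frobenioids.IsPerfect`. This file PROVES the two readings agree on Joshi's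
elementary Frobenioid of a valued field (`isPerfectDiv_iff_isPerfect_divMonoid`: a root of a value `≤ 1` is `≤ 1`,
and roots are unique among positive reals), whence Prop. 10.4.1.1 (1) in [FrdI]'s own vocabulary for algebraically
closed `K` (`isPerfect_divMonoid_of_isAlgClosed`). DERIVABLE row of plan/E/t34/INVENTORY.tsv (J3:Prop10.4.1.1),
discharged over E-t32's carriers (imported BY NAME; nothing restated).
-/

noncomputable section

namespace Summit.ABC.IUTFork.Joshi.ATS3.Frob

open Literature.AlgebraicGeometry.Frobenioids (IsPerfect)

universe u

variable {K : Type u} [Field K] (v : AbsoluteValue K ℝ)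

/-- Values in `Φ(K)^gp = |K^*|` are positive reals. [folklore] -/
theorem val_pos_of_mem_divGroup {r : ℝˣ} (hr : r ∈ divGroup v) : 0 < (r : ℝ) := by
  obtain ⟨x, rfl⟩ := hr
  rw [val_absUnits]
  exact v.pos x.ne_zero

/-- Values in `Φ(K) = |𝒪_K^▹|` are positive reals `≤ 1`. [folklore] -/
theorem val_pos_le_of_mem_divMonoid {r : ℝˣ} (hr : r ∈ divMonoid v) : 0 < (r : ℝ) ∧ (r : ℝ) ≤ 1 := by
  obtain ⟨x, hx, rfl⟩ := hr
  exact ⟨by rw [val_absUnits]; exact v.pos x.ne_zero, hx⟩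

/-- A value of `|K^*|` whose `n`-th power (`n ≥ 1`) lies in `Φ(K)` lies in `Φ(K)` ("saturatedness" of the value
monoid in the value group, [FrdI] §0). [folklore] -/
theorem mem_divMonoid_of_pow_mem {s : ℝˣ} (hs : s ∈ divGroup v) {n : ℕ} (hn : 0 < n)
    (hsn : s ^ n ∈ divMonoid v) : s ∈ divMonoid v := by
  obtain ⟨y, rfl⟩ := hs
  rw [absUnits_mem_divMonoid_iff]
  have h1 : (v (y : K)) ^ n ≤ 1 := by
    have := (val_pos_le_of_mem_divMonoid v hsn).2
    rwa [Units.val_pow_eq_pow_val, val_absUnits] at this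
  exact (pow_le_one_iff_of_nonneg (v.nonneg _) hn.ne').mp h1

/-- `n`-th powers are injective on `|K^*| ⊆ ℝ_{>0}` (the "bijective" half of [FrdI]'s perfectness that is automatic
for value groups, as E-t32's docstring of `IsPerfectDiv` notes). [folklore] -/
theorem pow_injOn_divGroup {n : ℕ} (hn : 0 < n) {a b : ℝˣ} (ha : a ∈ divGroup v) (hb : b ∈ divGroup v)
    (h : a ^ n = b ^ n) : a = b := by
  have h' : (a : ℝ) ^ n = (b : ℝ) ^ n := by
    rw [← Units.val_pow_eq_pow_val, ← Units.val_pow_eq_pow_val, h]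
  exact Units.ext ((pow_left_inj₀ (val_pos_of_mem_divGroup v ha).le (val_pos_of_mem_divGroup v hb).le hn.ne').mp h')

/-- **E-t32's group-level reading implies [FrdI]'s monoid-level perfectness of `Φ(K)`.** [folklore] -/
theorem isPerfect_divMonoid (h : IsPerfectDiv v) : IsPerfect (divMonoid v) := by
  refine ⟨fun n hn => ⟨fun a b hab => ?_, fun b => ?_⟩⟩
  · have h1 : (a : ℝˣ) ^ n = (b : ℝˣ) ^ n := by
      have := congrArg Subtype.val hab
      simpa only [SubmonoidClass.coe_pow] using this
    exact Subtype.ext (pow_injOn_divGroup v hn (divMonoid_le_divGroup v a.2) (divMonoid_le_divGroup v b.2) h1)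
  · obtain ⟨s, hs, hsn⟩ := h n hn b (divMonoid_le_divGroup v b.2)
    have hsΦ : s ∈ divMonoid v := mem_divMonoid_of_pow_mem v hs hn (hsn ▸ b.2)
    exact ⟨⟨s, hsΦ⟩, Subtype.ext (by simpa only [SubmonoidClass.coe_pow] using hsn)⟩

/-- **Conversely, [FrdI]'s perfectness of the monoid `Φ(K)` gives E-t32's `IsPerfectDiv`** (a value `> 1` is the
inverse of a value `< 1`). [folklore] -/
theorem isPerfectDiv_of_isPerfect_divMonoid (h : IsPerfect (divMonoid v)) : IsPerfectDiv v := by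
  intro n hn r hr
  obtain ⟨x, rfl⟩ := hr
  by_cases hx : v (x : K) ≤ 1
  · obtain ⟨a, ha⟩ := (h.bijective_pow n hn).2 ⟨absUnits v x, x, hx, rfl⟩
    refine ⟨a, divMonoid_le_divGroup v a.2, ?_⟩
    simpa only [SubmonoidClass.coe_pow] using congrArg Subtype.val ha
  · have hx' : v ((x⁻¹ : Kˣ) : K) ≤ 1 := by
      rw [Units.val_inv_eq_inv_val, map_inv₀]
      exact inv_le_one_of_one_le₀ (le_of_lt (not_le.mp hx))
    obtain ⟨a, ha⟩ := (h.bijective_pow n hn).2 ⟨absUnits v x⁻¹, x⁻¹, hx', rfl⟩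
    have ha' : (a : ℝˣ) ^ n = absUnits v x⁻¹ := by
      simpa only [SubmonoidClass.coe_pow] using congrArg Subtype.val ha
    refine ⟨(a : ℝˣ)⁻¹, (divGroup v).inv_mem (divMonoid_le_divGroup v a.2), ?_⟩
    rw [inv_pow, ha', map_inv, inv_inv]

/-- **The two readings of "`Frob(K)` is perfect" agree** on the elementary Frobenioid of a valued field: E-t32's
`IsPerfectDiv` (roots in `Φ(K)^gp`) ↔ [FrdI] §0 `IsPerfect` of the divisor monoid `Φ(K)` (our side's predicate,
`Literature.AlgebraicGeometry.Frobenioids.IsPerfect`). [folklore] -/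
theorem isPerfectDiv_iff_isPerfect_divMonoid : IsPerfectDiv v ↔ IsPerfect (divMonoid v) :=
  ⟨isPerfect_divMonoid v, isPerfectDiv_of_isPerfect_divMonoid v⟩

/-- **Prop. 10.4.1.1 (1) in [FrdI]'s vocabulary** (p.132 l.36–p.133 l.1, "perfect Frobenioid in the sense of
[Mochizuki, 2008, Definition 1.1]"; model-level content): for an algebraically closed valued field `K` — every
untilt `K_y` of an arithmetic holomorphic structure is such — the divisor monoid `Φ(K) = 𝒪_K^▹/𝒪_K^*` is a PERFECT
monoid. From E-t32's `isPerfectDiv_of_isAlgClosed`. [claim: Joshi2024ATS3, status: disputed] -/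
theorem isPerfect_divMonoid_of_isAlgClosed [IsAlgClosed K] : IsPerfect (divMonoid v) :=
  isPerfect_divMonoid v (isPerfectDiv_of_isAlgClosed v)

end Summit.ABC.IUTFork.Joshi.ATS3.Frob

end
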